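import Summits.MatrixMultiplication.MatrixMultiplication.Theorems.SoloInformedWeightedLaser
import Literature.Computability.AlgebraicComplexity.BorderRankSkewCW
import Literature.Computability.AlgebraicComplexity.AsymptoticSpectrum
import Literature.Computability.AlgebraicComplexity.AsymptoticRankBorderRank

/-!
# The carrier family `T_μ`: border rank and rank (`bR(T_μ) = R(T_μ) = 5` for `μ ∉ {0,1}`)

Solo deliverable (informed mode), complementing `SoloInformedWeightedLaser` (the unconditional door
`R̃(T_μ) ≤ 3 ⇒ ω = 2` for every member `T_μ = hCarrier μ`, `μ ≠ 0`, of the one-parameter family of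
Coppersmith–Winograd-shaped carriers, `c₀`-block `a₁b₂ + μ a₂b₁`; `T_1 ≅ T_{cw,2}`,
`T_{-1} = T_{skewcw,2}`).

* `rank_koszulBlock₁_hCarrier`: the `p = 1` Koszul flattening (Strassen–Ottaviani block form
  `[[0,-T₂,T₁],[-T₂,0,T₀],[-T₁,T₀,0]]`, `BorderRankSkewCW.koszulBlock₁`) of `T_μ` has full rank `9`
  for `μ ∉ {0, 1}` — the degree-`9` invariant `I₉ = det` separating the family from `T_{cw,2}`
  (rank `8`) does not vanish; hence `five_le_algBorderRank_hCarrier : 5 ≤ bR(T_μ)`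
  (`2·bR ≥ rank`, LO2015 Thm 2.1 as packaged in `rank_koszulBlock₁_le_two_mul_algBorderRank`).
* `hCarrier_eq_sum_five`: an explicit five-term decomposition of `T_μ`, uniform in `μ ≠ 0`
  (specialising at `μ = -1` to the tree's decomposition of `T_{skewcw,2}`), so `R(T_μ) ≤ 5`.
* `algBorderRank_hCarrier`, `tensorRank_hCarrier`: `bR(T_μ) = R(T_μ) = 5` (`μ ∉ {0,1}`): the
  Coppersmith–Winograd tensor is the UNIQUE member of the family of border rank `4`; CGLV's
  Prop. 3.1 (`bR(T_{skewcw,2}) = 5`) is the point `μ = -1` of a statement holding on the whole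
  punctured family. `asymptoticRank_hCarrier_le_five`: the kernel interval `R̃(T_μ) ∈ [3, 5]`.
-/

noncomputable section

namespace Summit.MatrixMultiplication.MatrixMultiplication.Theorems

open Literature.Computability.AlgebraicComplexity

namespace WeightedLaser

/-- The `p = 1` Koszul flattening (Strassen block form `[[0,-T₂,T₁],[-T₂,0,T₀],[-T₁,T₀,0]]`) of
`T_μ` has trivial kernel for `μ ∉ {0, 1}`: the nine sparse equations force `v = 0`, the last step
being `(1 - μ) v₀₀ = 0`. (At `μ = 1`, `T_1 ≅ T_{cw,2}` and the rank drops to `8`.)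
[cite: ConnerGesmundoLandsbergVentura2022, §4.1] -/
theorem koszulBlock₁_hCarrier_mulVec_eq_zero {μ : ℂ} (hμ0 : μ ≠ 0) (hμ1 : μ ≠ 1)
    (u : Fin 3 × Fin 3 → ℂ) (hu : (koszulBlock₁ (hCarrier μ)).mulVec u = 0) : u = 0 := by
  have e : ∀ r : Fin 3 × Fin 3,
      ∑ c : Fin 3 × Fin 3, koszulBlock₁ (hCarrier μ) r c * u c = 0 := by
    intro r
    have := congrFun hu r
    simpa [Matrix.mulVec, dotProduct] using this
  have e00 := e (0, 0)
  have e01 := e (0, 1)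
  have e02 := e (0, 2)
  have e10 := e (1, 0)
  have e11 := e (1, 1)
  have e12 := e (1, 2)
  have e20 := e (2, 0)
  have e21 := e (2, 1)
  have e22 := e (2, 2)
  simp [Fintype.sum_prod_type, Fin.sum_univ_three, koszulBlock₁_apply, hCarrier] at e00
  simp [Fintype.sum_prod_type, Fin.sum_univ_three, koszulBlock₁_apply, hCarrier] at e01
  simp [Fintype.sum_prod_type, Fin.sum_univ_three, koszulBlock₁_apply, hCarrier] at e02
  simp [Fintype.sum_prod_type, Fin.sum_univ_three, koszulBlock₁_apply, hCarrier] at e10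
  simp [Fintype.sum_prod_type, Fin.sum_univ_three, koszulBlock₁_apply, hCarrier] at e11
  simp [Fintype.sum_prod_type, Fin.sum_univ_three, koszulBlock₁_apply, hCarrier] at e12
  simp [Fintype.sum_prod_type, Fin.sum_univ_three, koszulBlock₁_apply, hCarrier] at e20
  simp [Fintype.sum_prod_type, Fin.sum_univ_three, koszulBlock₁_apply, hCarrier] at e21
  simp [Fintype.sum_prod_type, Fin.sum_univ_three, koszulBlock₁_apply, hCarrier] at e22
  have h01 : u (0, 1) = 0 := by simpa [hμ0] using e10
  have h00 : u (0, 0) = 0 := by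
    have h : (1 - μ) * u (0, 0) = 0 := by linear_combination e00 - e12 + μ * e21
    exact (mul_eq_zero.1 h).resolve_left (sub_ne_zero.2 (Ne.symm hμ1))
  have h11 : u (1, 1) = 0 := by linear_combination e21 + h00
  have h22 : u (2, 2) = 0 := by linear_combination e12 + h00
  funext ⟨a, b⟩
  fin_cases a <;> fin_cases b
  · exact h00
  · exact h01
  · simpa using e20
  · simpa using e02
  · exact h11
  · simpa using e22
  · simpa using e01
  · simpa using e11
  · exact h22

/-- **Rank `9`** of the `p = 1` Koszul flattening of `T_μ`, `μ ∉ {0,1}` (the degree-`9` invariant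
`I₉ = det` does not vanish; for `T_{cw,2}` the rank is `8`).
[cite: ConnerGesmundoLandsbergVentura2022, §4.1] -/
theorem rank_koszulBlock₁_hCarrier {μ : ℂ} (hμ0 : μ ≠ 0) (hμ1 : μ ≠ 1) :
    (koszulBlock₁ (hCarrier μ)).rank = 9 := by
  have hinj : Function.Injective (koszulBlock₁ (hCarrier μ)).mulVecLin := by
    intro v w h
    have h0 : (koszulBlock₁ (hCarrier μ)).mulVec (v - w) = 0 := by
      rw [Matrix.mulVec_sub]
      exact sub_eq_zero.2 h
    exact sub_eq_zero.1 (koszulBlock₁_hCarrier_mulVec_eq_zero hμ0 hμ1 _ h0)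
  rw [Matrix.rank, LinearMap.finrank_range_of_inj hinj]
  simp

/-- **`bR(T_μ) ≥ 5` for `μ ∉ {0, 1}`** (`2 · bR ≥ rank T_A^{∧1} = 9`): in the family of carriers,
`T_{cw,2}` (`≅ T_1`, border rank `4`) is the unique member of border rank `4`; the skew cousin
(`μ = -1`, `bR = 5`, CGLV Prop. 3.1) is not special in this respect.
[cite: ConnerGesmundoLandsbergVentura2022, Prop. 3.1, §4.1] -/
theorem five_le_algBorderRank_hCarrier {μ : ℂ} (hμ0 : μ ≠ 0) (hμ1 : μ ≠ 1) :
    5 ≤ algBorderRank (hCarrier μ) := by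
  have h := rank_koszulBlock₁_le_two_mul_algBorderRank (TensorRestrictsTo.refl (hCarrier μ))
  rw [rank_koszulBlock₁_hCarrier hμ0 hμ1] at h
  omega


/-! ## `R(T_μ) ≤ 5`: an explicit five-term decomposition, uniform in `μ ≠ 0` -/

/-- First factors of a five-term decomposition of `T_μ` (`μ ≠ 0`). [folklore] -/
def hFive₁ (μ : ℂ) : Fin 5 → Fin 3 → ℂ :=
  ![![0, μ⁻¹, 0], ![-1, 0, μ], ![1, 0, 0], ![0, -μ⁻¹, 1], ![1, 1, -μ]]

/-- Second factors of a five-term decomposition of `T_μ` (`μ ≠ 0`). [folklore] -/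
def hFive₂ (μ : ℂ) : Fin 5 → Fin 3 → ℂ :=
  ![![1, 0, 0], ![0, 1, 1], ![0, 1, 0], ![1, 0, μ], ![0, 0, 1]]

/-- Third factors of a five-term decomposition of `T_μ` (`μ ≠ 0`). [folklore] -/
def hFive₃ (μ : ℂ) : Fin 5 → Fin 3 → ℂ :=
  ![![0, μ, 1], ![1, 0, 0], ![1, 1, 0], ![0, 0, 1], ![1, 0, 1]]

/-- **`T_μ` is a sum of five triads** for every `μ ≠ 0`:
`T_μ = μ⁻¹a₁⊗b₀⊗(μc₁+c₂) − (a₀−μa₂)⊗(b₁+b₂)⊗c₀ + a₀⊗b₁⊗(c₀+c₁) + (a₂−μ⁻¹a₁)⊗(b₀+μb₂)⊗c₂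
  + (a₀+a₁−μa₂)⊗b₂⊗(c₀+c₂)` (at `μ = -1` this is the tree's five-term decomposition of
`T_{skewcw,2}`; found by requiring the three `c`-slices to lie in the span of five rank-one forms
`a₁b₀, (a₀−μa₂)(b₁+b₂), a₀b₁, (a₁−μa₂)(b₀+μb₂), (a₀+a₁−μa₂)b₂`; checked entrywise).
[cite: ConnerGesmundoLandsbergVentura2022, §2.2] -/
theorem hCarrier_eq_sum_five {μ : ℂ} (hμ0 : μ ≠ 0) :
    hCarrier μ = ∑ i, triad (hFive₁ μ i) (hFive₂ μ i) (hFive₃ μ i) := by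
  funext a b c
  rw [sum_triad_apply, Fin.sum_univ_five]
  fin_cases a <;> fin_cases b <;> fin_cases c <;> simp [hCarrier, hFive₁, hFive₂, hFive₃, hμ0]

/-- `R(T_μ) ≤ 5` (`μ ≠ 0`). [cite: ConnerGesmundoLandsbergVentura2022, §2.2] -/
theorem tensorRank_hCarrier_le_five {μ : ℂ} (hμ0 : μ ≠ 0) : tensorRank (hCarrier μ) ≤ 5 :=
  tensorRank_le_of_eq_sum _ _ _ (hCarrier_eq_sum_five hμ0)

/-- **`bR(T_μ) = R(T_μ) = 5` for every `μ ∉ {0, 1}`**: in the one-parameter family of carriers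
the Coppersmith–Winograd tensor (`T_1 ≅ T_{cw,2}`, `bR = R = 4`) is the unique member of border
rank `4`; every other member — not only the skew cousin `T_{-1} = T_{skewcw,2}` of CGLV
Prop. 3.1 — has border rank and rank exactly `5`.
[cite: ConnerGesmundoLandsbergVentura2022, Prop. 3.1] -/
theorem algBorderRank_hCarrier {μ : ℂ} (hμ0 : μ ≠ 0) (hμ1 : μ ≠ 1) :
    algBorderRank (hCarrier μ) = 5 :=
  le_antisymm ((algBorderRank_le_tensorRank _).trans (tensorRank_hCarrier_le_five hμ0))
    (five_le_algBorderRank_hCarrier hμ0 hμ1)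

/-- `R(T_μ) = 5` for `μ ∉ {0, 1}`. [cite: ConnerGesmundoLandsbergVentura2022, Prop. 3.1] -/
theorem tensorRank_hCarrier {μ : ℂ} (hμ0 : μ ≠ 0) (hμ1 : μ ≠ 1) : tensorRank (hCarrier μ) = 5 :=
  le_antisymm (tensorRank_hCarrier_le_five hμ0)
    ((five_le_algBorderRank_hCarrier hμ0 hμ1).trans (algBorderRank_le_tensorRank _))

/-- The kernel interval for the asymptotic rank of a generic carrier: `3 ≤ R̃(T_μ) ≤ 5`
(`μ ∉ {0,1}`; lower bound `three_le_asymptoticRank_hCarrier`, upper bound `R̃ ≤ bR = 5`). The door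
`R̃(T_μ) = 3 ⇒ ω = 2` (`matrixMultiplication_of_asymptoticRank_hCarrier_le_three`) asks for the
bottom of this interval. [cite: BurgisserClausenShokrollahi1997, Lemma (15.27)] -/
theorem asymptoticRank_hCarrier_le_five {μ : ℂ} (hμ0 : μ ≠ 0) (hμ1 : μ ≠ 1) :
    asymptoticRank (hCarrier μ) ≤ 5 := by
  have h := asymptoticRank_le_algBorderRank (hCarrier μ)
  rw [algBorderRank_hCarrier hμ0 hμ1] at h
  exact_mod_cast h

end WeightedLaser

end Summit.MatrixMultiplication.MatrixMultiplication.Theorems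

end
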